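import Literature.AlgebraicGeometry.Frobenioids.Thm36SubInstancesA
import Literature.AlgebraicGeometry.Frobenioids.ArchimedeanAmpleness
import Literature.AlgebraicGeometry.Frobenioids.ArchimedeanAngularModel
import Literature.AlgebraicGeometry.Frobenioids.ArchimedeanIsometrization
import Literature.AlgebraicGeometry.Frobenioids.ArchimedeanIsometrizationEquivalence
import Literature.AlgebraicGeometry.Frobenioids.ArchimedeanUnitCircle
import Literature.AlgebraicGeometry.Frobenioids.ArchimedeanUnitCircleAngular
import Literature.AlgebraicGeometry.Frobenioids.ArchimedeanWeaklyDissectible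
import Literature.AlgebraicGeometry.Frobenioids.ArchimedeanPointBase
import HarnessLib

/-!
# Frobenioids II, Theorem 3.6 (ii), (iii), (v), (viii) — the schema predicates of
# `ArchimedeanBasicProperties.lean` CLOSED AT THE GENUINE CARRIERS of Example 3.3 (proof-only bridging file)

Mochizuki, *The geometry of Frobenioids II: poly-Frobenioids*, Kyushu J. Math. **62** (2008) 401–460, §3,
Example 3.3 p. 27–29 and Theorem 3.6 (ii), (iii), (v), (viii) pp. 37–38 [cite: MochizukiFrdII2008, Thm 3.6 pp.36-38].

WHY THIS FILE (abc-iut cell, D-0079 sub-cell L-F [FrdI/II], table `plan/L1/LF-FRD.tsv` pack A; seat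
abc-iut-f-009 gen 4).  The statements of `ArchimedeanBasicProperties.lean` (seat abc-iut-L1-t9) are SCHEMA
predicates `ArchFrd.Thm36…` binding the structure functor `F` (and `Λ`, the base `G : D → D₀`, …) freely; their
universal closures are refuted in the tree (`ArchimedeanBasicPropertiesSchemaNegative*.lean`), and the printed
claims are the instantiations at the categories of Example 3.3: `F := C.toElem π` (`C^ℤ = C = C₀ ×_{D₀} D`),
THE perfection `C^ℚ := C^pf` (`Thm36Sub.pfStr π hF`, [FrdI] Def. 3.1 (iii), under `hF :` "`C` is a Frobenioid",
Ex. 3.3 (ii) — discharged for connected, totally epimorphic `D` by `ArchFrd.Ex33ii_isFrobenioid_holds`), THE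
realification `C^ℝ := C^rlf` (`Thm36Sub.rlfStr π`, [FrdI] Prop. 5.3) and the angular Frobenioid `F := A.toElem π`,
over an ARBITRARY base `π : D → D₀`.  Every one of these instance forms is ALREADY PROVED in the tree, but several
closers conclude in a WRAPPER definition (`Thm36ii_ampleTypes_A`, `Thm36ii_istrModel_A`, `Thm36iii_factorization_C`,
`Thm36iii_equivalence_C` of `ArchimedeanTheoremsInstances.lean` / `ArchimedeanIsometrizationFunctors.lean`;
`Thm36Sub.v_Q`, `v_R`, `viii_Q`, `viii_R` of `Thm36Sub.lean`) rather than in the schema predicate itself.  This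
file re-heads them, ONE LINE EACH, so that every FACT-LIST row below has a kernel theorem whose conclusion head
IS the row's declaration at each genuine carrier (the cell's head-matcher reads heads mechanically):

* F-0781 `Thm36ii_ampleTypes`, F-0783 `Thm36ii_istrModel` (Thm. 3.6 (ii), `F = A`);
* F-0784 `Thm36iii_factorization`, F-0694 `Thm36iii_equivalence` (Thm. 3.6 (iii), `F = C`);
* F-0789 … F-0794 `Thm36v_isoCircle`, `Thm36v_isoCircleTensorRat`, `Thm36v_orderTwo`, `Thm36v_torsion`,
  `Thm36v_torsionFree`, `Thm36v_trivial` (Thm. 3.6 (v), `F ∈ {C^Λ, A}`) at `C^pf` and `C^rlf`;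
* F-1300 `Thm36viii` (Thm. 3.6 (viii), `F ∈ {C^Λ, A}`) at `C^pf` and `C^rlf` (vacuous there: "(viii) If `Λ = ℤ` …").

Closers of record whose head is ALREADY the schema predicate (not restated here, cited for the row census):
F-0782 `thm36ii_istrBaseTrivial_A` (`ArchimedeanAngularIstr.lean`); (v) at `C`, `Λ = ℤ`:
`UnitStab.thm36v_trivial_C`, `UnitStab.thm36v_orderTwo_C`, `UnitStab.thm36v_torsion_C`,
`UnitStab.thm36v_torsionFree_C`, `UnitStab.thm36v_isoCircleTensorRat_C` (`ArchimedeanUnitStabilizersThm36v.lean`),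
`thm36v_isoCircle_C` (`ArchimedeanUnitCircle.lean`); (v) at `A`: `thm36v_trivial_A`, `thm36v_orderTwo_A`,
`thm36v_torsion_A`, `thm36v_torsionFree_A`, `thm36v_isoCircleTensorRat_A` (`ArchimedeanUnitGroupsAngular.lean`),
`thm36v_isoCircle_A` (`ArchimedeanUnitCircleAngular.lean`); (viii) at `C` / `A`: `thm36viii_C`, `thm36viii_A`
(`ArchimedeanWeaklyDissectible.lean`).

PROOF-ONLY: no `def`, no new `Prop`, no restated schema; every theorem is a term of an existing theorem.  Honest
framing: FACT rows are assumption LABELS on OUR typed statements of the refereed [FrdII]; "proved" = OUR kernel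
check of OUR typed instance form; nothing here asserts abc proved or refuted; no side taken on [IUTchIII] Cor. 3.12;
typed ≠ proved.
-/

noncomputable section

namespace Literature.AlgebraicGeometry.Frobenioids

open CategoryTheory Opposite

universe v u

namespace ArchFrd

variable {D : Type u} [Category.{v} D] (π : D ⥤ D0)

/-! ### Theorem 3.6 (ii): the angular Frobenioid `A` (F-0781, F-0783) -/

/-- **Thm. 3.6 (ii)**, typology clauses, AT THE GENUINE CARRIER `F := A.toElem π` (FACT row F-0781
`Thm36ii_ampleTypes`): "The Frobenioid `A` is of `Aut`-ample, `Aut^sub`-ample, `End`-ample, group-like, and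
metrically trivial type" — re-headed from `thm36ii_ampleTypes_A` (`ArchimedeanAmpleness.lean`), over any base
`π : D → D₀`. [cite: MochizukiFrdII2008, Thm 3.6 (ii) p.37] -/
theorem thm36ii_ampleTypes_inst_A : Thm36ii_ampleTypes (A.toElem π) :=
  thm36ii_ampleTypes_A π

/-- **Thm. 3.6 (ii)**, "model type" clause, AT THE GENUINE CARRIER `F := A.toElem π` with the model Frobenioid of
the datum `Φ^∡ → 0^gp` (FACT row F-0783 `Thm36ii_istrModel`): "`A^istr` is of […] model type, with rational
function monoid naturally isomorphic to `Φ^∡`" — re-headed from `thm36ii_istrModel_A` (`ArchimedeanAngularModel.lean`).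
[cite: MochizukiFrdII2008, Thm 3.6 (ii) p.37] -/
theorem thm36ii_istrModel_inst_A :
    Thm36ii_istrModel (A.toElem π)
      (ModelFrobenioid.toElem (zeroMonoid D : Dᵒᵖ ⥤ CommMonCat.{0}) (unitMonoid π) (unitMonoidDivZero π)) :=
  thm36ii_istrModel_A π

/-! ### Theorem 3.6 (iii): the isometrization functor of `C` (F-0784, F-0694) -/

/-- **Thm. 3.6 (iii)**, factorization `φ = β ∘ α`, AT THE GENUINE CARRIER `F := C.toElem π` with the radial
endomorphisms `radial π` of Example 3.3 (FACT row F-0784 `Thm36iii_factorization`): "Every morphism `φ : B → A` of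
`C` factors uniquely as a composite `φ = β ∘ α`, where `α` is an isometry, and `β ∈ O^▷(A)` belongs to the
submonoid `Φ^gp(A) × {1} ⊆ Φ^fld(A)`" — re-headed from `thm36iii_factorization_C` (`ArchimedeanIsometrization.lean`).
[cite: MochizukiFrdII2008, Thm 3.6 (iii) p.37] -/
theorem thm36iii_factorization_inst_C : Thm36iii_factorization (C.toElem π) (radial π) :=
  thm36iii_factorization_C π

/-- **Thm. 3.6 (iii)**, the equivalence `C ⥲ A ×_{A^istr} C^istr`, AT THE GENUINE CARRIER `F := C.toElem π` with
the isometrization / isotropification functors of `ArchimedeanIsometrizationFunctors.lean` (FACT row F-0694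
`Thm36iii_equivalence`): "determines an equivalence of categories `C ⥲ A ×_{A^istr} C^istr` that is 1-compatible
with the natural functors to `F_Φ` on both sides" — re-headed from `thm36iii_equivalence_C`
(`ArchimedeanIsometrizationEquivalence.lean`). [cite: MochizukiFrdII2008, Thm 3.6 (iii) p.37] -/
theorem thm36iii_equivalence_inst_C :
    Thm36iii_equivalence (C.toElem π) (isomFunctor π) (A.istrFunctor π) (istrFunctor π) (isomIFunctor π)
      (eIso π) (istr (C.toElem π)) :=
  thm36iii_equivalence_C π

/-! ### Theorem 3.6 (v): the groups `O^×(A)` for `C^ℚ := C^pf` and `C^ℝ := C^rlf` (F-0789 … F-0794) -/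

section Perfection

variable (hF : PreFrobenioid.IsFrobenioid (C.toElem π))

/-- **Thm. 3.6 (v)** "`O^×(A)` is trivial iff (a) … (b) `Λ = ℚ` and `A` is real, or (c) …", AT THE GENUINE CARRIER
`C^ℚ := C^pf` = THE perfection of `C → F_Φ` (FACT row F-0794 `Thm36v_trivial`, `Λ = ℚ`) — the first conjunct of
`Thm36Sub.v_Q_holds` (`Thm36SubPerfectionUnitsQ.lean`). [cite: MochizukiFrdII2008, Thm 3.6 (v) p.37] -/
theorem thm36v_trivial_inst_pf : Thm36v_trivial (baseRC π) (Thm36Sub.pfStr π hF) .Q :=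
  (Thm36Sub.v_Q_holds π hF).1

/-- **Thm. 3.6 (v)** "`O^×(A)` is nontrivial and torsion free iff `Λ = ℚ` and `A` is complex", AT `C^ℚ := C^pf`
(FACT row F-0793 `Thm36v_torsionFree`, `Λ = ℚ`). [cite: MochizukiFrdII2008, Thm 3.6 (v) p.37] -/
theorem thm36v_torsionFree_inst_pf : Thm36v_torsionFree (baseRC π) (Thm36Sub.pfStr π hF) .Q :=
  (Thm36Sub.v_Q_holds π hF).2.1

/-- **Thm. 3.6 (v)** "[and in fact isomorphic to `S¹ ⊗_ℤ ℚ`]", AT `C^ℚ := C^pf` (FACT row F-0790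
`Thm36v_isoCircleTensorRat`, `Λ = ℚ`). [cite: MochizukiFrdII2008, Thm 3.6 (v) p.37] -/
theorem thm36v_isoCircleTensorRat_inst_pf : Thm36v_isoCircleTensorRat (baseRC π) (Thm36Sub.pfStr π hF) .Q :=
  (Thm36Sub.v_Q_holds π hF).2.2.1

/-- **Thm. 3.6 (v)** "`O^×(A)` is of order two iff `Λ = ℤ` and `A` is real" [so never at `Λ = ℚ`], AT `C^ℚ := C^pf`
(FACT row F-0791 `Thm36v_orderTwo`, `Λ = ℚ`). [cite: MochizukiFrdII2008, Thm 3.6 (v) p.37] -/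
theorem thm36v_orderTwo_inst_pf : Thm36v_orderTwo (baseRC π) (Thm36Sub.pfStr π hF) .Q :=
  (Thm36Sub.v_Q_holds π hF).2.2.2.1

/-- **Thm. 3.6 (v)** "`O^×(A)` has infinitely many torsion elements iff `Λ = ℤ` and `A` is complex isotropic"
[so never at `Λ = ℚ`], AT `C^ℚ := C^pf` (FACT row F-0792 `Thm36v_torsion`, `Λ = ℚ`).
[cite: MochizukiFrdII2008, Thm 3.6 (v) p.37] -/
theorem thm36v_torsion_inst_pf : Thm36v_torsion (baseRC π) (Thm36Sub.pfStr π hF) .Q :=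
  (Thm36Sub.v_Q_holds π hF).2.2.2.2.1

/-- **Thm. 3.6 (v)** "[and is in fact isomorphic to `S¹`]" (the `Λ = ℤ` bracket — vacuous premise at `Λ = ℚ`),
AT `C^ℚ := C^pf` (FACT row F-0789 `Thm36v_isoCircle`, `Λ = ℚ`). [cite: MochizukiFrdII2008, Thm 3.6 (v) p.37] -/
theorem thm36v_isoCircle_inst_pf : Thm36v_isoCircle (baseRC π) (Thm36Sub.pfStr π hF) .Q :=
  (Thm36Sub.v_Q_holds π hF).2.2.2.2.2

/-- **Thm. 3.6 (viii)** "If `Λ = ℤ`, then `F[ℂ]` is of weakly dissectible type" — VACUOUS at `Λ = ℚ`, AT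
`C^ℚ := C^pf` (FACT row F-1300 `Thm36viii`, `Λ = ℚ`; `Thm36Sub.viii_Q_holds`).
[cite: MochizukiFrdII2008, Thm 3.6 (viii) p.38] -/
theorem thm36viii_inst_pf : Thm36viii (baseRC π) (Thm36Sub.pfStr π hF) .Q :=
  Thm36Sub.viii_Q_holds π hF

end Perfection

/-- **Thm. 3.6 (v)** "`O^×(A)` is trivial iff … (c) `Λ = ℝ`", AT THE GENUINE CARRIER `C^ℝ := C^rlf` = THE
realification of `C → F_Φ` (FACT row F-0794 `Thm36v_trivial`, `Λ = ℝ`) — the first conjunct of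
`Thm36Sub.v_R_holds` (`Thm36SubProofs.lean`). [cite: MochizukiFrdII2008, Thm 3.6 (v) p.37] -/
theorem thm36v_trivial_inst_rlf : Thm36v_trivial (baseRC π) (Thm36Sub.rlfStr π) .R :=
  (Thm36Sub.v_R_holds π).1

/-- **Thm. 3.6 (v)** "nontrivial and torsion free iff `Λ = ℚ` and `A` is complex" [so never at `Λ = ℝ`], AT
`C^ℝ := C^rlf` (FACT row F-0793 `Thm36v_torsionFree`, `Λ = ℝ`). [cite: MochizukiFrdII2008, Thm 3.6 (v) p.37] -/
theorem thm36v_torsionFree_inst_rlf : Thm36v_torsionFree (baseRC π) (Thm36Sub.rlfStr π) .R :=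
  (Thm36Sub.v_R_holds π).2.1

/-- **Thm. 3.6 (v)** "[isomorphic to `S¹ ⊗_ℤ ℚ`]" (the `Λ = ℚ` bracket — vacuous premise at `Λ = ℝ`), AT
`C^ℝ := C^rlf` (FACT row F-0790 `Thm36v_isoCircleTensorRat`, `Λ = ℝ`). [cite: MochizukiFrdII2008, Thm 3.6 (v) p.37] -/
theorem thm36v_isoCircleTensorRat_inst_rlf : Thm36v_isoCircleTensorRat (baseRC π) (Thm36Sub.rlfStr π) .R :=
  (Thm36Sub.v_R_holds π).2.2.1

/-- **Thm. 3.6 (v)** "of order two iff `Λ = ℤ` and `A` is real" [so never at `Λ = ℝ`], AT `C^ℝ := C^rlf`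
(FACT row F-0791 `Thm36v_orderTwo`, `Λ = ℝ`). [cite: MochizukiFrdII2008, Thm 3.6 (v) p.37] -/
theorem thm36v_orderTwo_inst_rlf : Thm36v_orderTwo (baseRC π) (Thm36Sub.rlfStr π) .R :=
  (Thm36Sub.v_R_holds π).2.2.2.1

/-- **Thm. 3.6 (v)** "infinitely many torsion elements iff `Λ = ℤ` and `A` is complex isotropic" [so never at
`Λ = ℝ`], AT `C^ℝ := C^rlf` (FACT row F-0792 `Thm36v_torsion`, `Λ = ℝ`). [cite: MochizukiFrdII2008, Thm 3.6 (v) p.37] -/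
theorem thm36v_torsion_inst_rlf : Thm36v_torsion (baseRC π) (Thm36Sub.rlfStr π) .R :=
  (Thm36Sub.v_R_holds π).2.2.2.2.1

/-- **Thm. 3.6 (v)** "[isomorphic to `S¹`]" (the `Λ = ℤ` bracket — vacuous premise at `Λ = ℝ`), AT `C^ℝ := C^rlf`
(FACT row F-0789 `Thm36v_isoCircle`, `Λ = ℝ`). [cite: MochizukiFrdII2008, Thm 3.6 (v) p.37] -/
theorem thm36v_isoCircle_inst_rlf : Thm36v_isoCircle (baseRC π) (Thm36Sub.rlfStr π) .R :=
  (Thm36Sub.v_R_holds π).2.2.2.2.2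

/-- **Thm. 3.6 (viii)** "If `Λ = ℤ`, then `F[ℂ]` is of weakly dissectible type" — VACUOUS at `Λ = ℝ`, AT
`C^ℝ := C^rlf` (FACT row F-1300 `Thm36viii`, `Λ = ℝ`; `Thm36Sub.viii_R_holds`).
[cite: MochizukiFrdII2008, Thm 3.6 (viii) p.38] -/
theorem thm36viii_inst_rlf : Thm36viii (baseRC π) (Thm36Sub.rlfStr π) .R :=
  Thm36Sub.viii_R_holds π

/-! ### Census theorems: each row at ALL its genuine carriers in one conjunction

One theorem per FACT row of Thm. 3.6 (v) / (viii) (`F ∈ {C^Λ, A}`, all `Λ`), assembling the four genuine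
carriers `C = C^ℤ`, `C^pf = C^ℚ`, `C^rlf = C^ℝ`, `A` BY NAME — the print-generality closer of the row over an
arbitrary base `π : D → D₀` (the perfection under `hF :` "`C` is a Frobenioid"). -/

section Census

variable (hF : PreFrobenioid.IsFrobenioid (C.toElem π))

/-- **Thm. 3.6 (v)**, "`O^×(A)` is trivial iff (a)/(b)/(c)", for ALL `F ∈ {C^ℤ, C^ℚ, C^ℝ, A}` of Example 3.3
(FACT row F-0794 at every genuine carrier). [cite: MochizukiFrdII2008, Thm 3.6 (v) p.37] -/
theorem thm36v_trivial_inst_all :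
    Thm36v_trivial (baseRC π) (C.toElem π) .Z ∧ Thm36v_trivial (baseRC π) (Thm36Sub.pfStr π hF) .Q ∧
      Thm36v_trivial (baseRC π) (Thm36Sub.rlfStr π) .R ∧ Thm36v_trivial (baseRC π) (A.toElem π) .Z :=
  ⟨UnitStab.thm36v_trivial_C π, thm36v_trivial_inst_pf π hF, thm36v_trivial_inst_rlf π, thm36v_trivial_A π⟩

/-- **Thm. 3.6 (v)**, "nontrivial and torsion free iff `Λ = ℚ` and `A` complex", for ALL `F ∈ {C^ℤ, C^ℚ, C^ℝ, A}`
(FACT row F-0793 at every genuine carrier). [cite: MochizukiFrdII2008, Thm 3.6 (v) p.37] -/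
theorem thm36v_torsionFree_inst_all :
    Thm36v_torsionFree (baseRC π) (C.toElem π) .Z ∧ Thm36v_torsionFree (baseRC π) (Thm36Sub.pfStr π hF) .Q ∧
      Thm36v_torsionFree (baseRC π) (Thm36Sub.rlfStr π) .R ∧ Thm36v_torsionFree (baseRC π) (A.toElem π) .Z :=
  ⟨UnitStab.thm36v_torsionFree_C π, thm36v_torsionFree_inst_pf π hF, thm36v_torsionFree_inst_rlf π,
    thm36v_torsionFree_A π⟩

/-- **Thm. 3.6 (v)**, "[`≅ S¹ ⊗_ℤ ℚ`]", for ALL `F ∈ {C^ℤ, C^ℚ, C^ℝ, A}` (FACT row F-0790 at every genuine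
carrier). [cite: MochizukiFrdII2008, Thm 3.6 (v) p.37] -/
theorem thm36v_isoCircleTensorRat_inst_all :
    Thm36v_isoCircleTensorRat (baseRC π) (C.toElem π) .Z ∧
      Thm36v_isoCircleTensorRat (baseRC π) (Thm36Sub.pfStr π hF) .Q ∧
      Thm36v_isoCircleTensorRat (baseRC π) (Thm36Sub.rlfStr π) .R ∧
      Thm36v_isoCircleTensorRat (baseRC π) (A.toElem π) .Z :=
  ⟨UnitStab.thm36v_isoCircleTensorRat_C π, thm36v_isoCircleTensorRat_inst_pf π hF,
    thm36v_isoCircleTensorRat_inst_rlf π, thm36v_isoCircleTensorRat_A π⟩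

/-- **Thm. 3.6 (v)**, "of order two iff `Λ = ℤ` and `A` real", for ALL `F ∈ {C^ℤ, C^ℚ, C^ℝ, A}` (FACT row F-0791
at every genuine carrier). [cite: MochizukiFrdII2008, Thm 3.6 (v) p.37] -/
theorem thm36v_orderTwo_inst_all :
    Thm36v_orderTwo (baseRC π) (C.toElem π) .Z ∧ Thm36v_orderTwo (baseRC π) (Thm36Sub.pfStr π hF) .Q ∧
      Thm36v_orderTwo (baseRC π) (Thm36Sub.rlfStr π) .R ∧ Thm36v_orderTwo (baseRC π) (A.toElem π) .Z :=
  ⟨UnitStab.thm36v_orderTwo_C π, thm36v_orderTwo_inst_pf π hF, thm36v_orderTwo_inst_rlf π, thm36v_orderTwo_A π⟩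

/-- **Thm. 3.6 (v)**, "infinitely many torsion elements iff `Λ = ℤ` and `A` complex isotropic", for ALL
`F ∈ {C^ℤ, C^ℚ, C^ℝ, A}` (FACT row F-0792 at every genuine carrier). [cite: MochizukiFrdII2008, Thm 3.6 (v) p.37] -/
theorem thm36v_torsion_inst_all :
    Thm36v_torsion (baseRC π) (C.toElem π) .Z ∧ Thm36v_torsion (baseRC π) (Thm36Sub.pfStr π hF) .Q ∧
      Thm36v_torsion (baseRC π) (Thm36Sub.rlfStr π) .R ∧ Thm36v_torsion (baseRC π) (A.toElem π) .Z :=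
  ⟨UnitStab.thm36v_torsion_C π, thm36v_torsion_inst_pf π hF, thm36v_torsion_inst_rlf π, thm36v_torsion_A π⟩

/-- **Thm. 3.6 (v)**, "[`≅ S¹`]", for ALL `F ∈ {C^ℤ, C^ℚ, C^ℝ, A}` (FACT row F-0789 at every genuine carrier).
[cite: MochizukiFrdII2008, Thm 3.6 (v) p.37] -/
theorem thm36v_isoCircle_inst_all :
    Thm36v_isoCircle (baseRC π) (C.toElem π) .Z ∧ Thm36v_isoCircle (baseRC π) (Thm36Sub.pfStr π hF) .Q ∧
      Thm36v_isoCircle (baseRC π) (Thm36Sub.rlfStr π) .R ∧ Thm36v_isoCircle (baseRC π) (A.toElem π) .Z :=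
  ⟨thm36v_isoCircle_C π, thm36v_isoCircle_inst_pf π hF, thm36v_isoCircle_inst_rlf π, thm36v_isoCircle_A π⟩

/-- **Thm. 3.6 (viii)**, "if `Λ = ℤ`, then `F[ℂ]` is of weakly dissectible type", for ALL `F ∈ {C^ℤ, C^ℚ, C^ℝ, A}`
(FACT row F-1300 at every genuine carrier; contentful at `C`, `A`, vacuous at `C^pf`, `C^rlf`).
[cite: MochizukiFrdII2008, Thm 3.6 (viii) p.38] -/
theorem thm36viii_inst_all :
    Thm36viii (baseRC π) (C.toElem π) .Z ∧ Thm36viii (baseRC π) (Thm36Sub.pfStr π hF) .Q ∧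
      Thm36viii (baseRC π) (Thm36Sub.rlfStr π) .R ∧ Thm36viii (baseRC π) (A.toElem π) .Z :=
  ⟨thm36viii_C π, thm36viii_inst_pf π hF, thm36viii_inst_rlf π, thm36viii_A π⟩

end Census


/-! ### Theorem 3.6 (i), typology clauses, for `C^ℝ := C^rlf` (FACT row F-2716 `Thm36Sub.ampleTypes_R`)

APPENDED (same seat, LF-FRD offer row F-2716, a MODEL row: "proved under a standing hypothesis only").  The
slot `Thm36Sub.ampleTypes_R π := Thm36i_ampleTypes (rlfStr π)` is closed in the tree by
`Thm36Sub.ampleTypes_R_holds (hD : IsGraphConnected D)` (`Thm36SubProofs3.lean`) under print's own standing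
hypothesis "`D` connected" (Ex. 3.3 (i) p. 28 ll. 20–21; needed: over the EMPTY base `C^rlf` is of group-like
type, `Thm36Sub.not_forall_ampleTypes_R`, seat abc-iut-f-045).  Recorded here: the same instance with the
hypothesis read off "`C` is a Frobenioid" (as `Thm36SubInstancesB.lean` does), the HYPOTHESIS-FREE instance at
THE archimedean base of [IUTchI] Ex. 3.4 (i) (`ArchFrd.ptBase`, connected by `pt_isGraphConnected`), and the
unfolded schema head `Thm36i_ampleTypes` at the carrier `C^rlf`. -/

/-- **Thm. 3.6 (i)**, typology clauses ("`Aut`-ample, `Aut^sub`-ample, `End`-ample, metrically trivial, not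
group-like") for `C^ℝ := C^rlf` = THE realification of `C → F_Φ` (FACT row F-2716), the connectedness of `D`
read off `hF :` "`C` is a Frobenioid" ([FrdI] Def. 1.1: the base of a Frobenioid is connected).
[cite: MochizukiFrdII2008, Thm 3.6 (i) p.36] -/
theorem Thm36Sub.ampleTypes_R_of_isFrobenioid (hF : PreFrobenioid.IsFrobenioid (C.toElem π)) :
    Thm36Sub.ampleTypes_R π :=
  Thm36Sub.ampleTypes_R_holds π hF.isPreFrobenioid.isGraphConnected_base

/-- **Thm. 3.6 (i)**, typology clauses for `C_v^ℝ := (C_v)^rlf` AT THE archimedean base of [IUTchI] Ex. 3.4 (i)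
(FACT row F-2716 at the genuine IUT instance, NO hypothesis: the one-morphism base is connected,
`pt_isGraphConnected`). [cite: MochizukiFrdII2008, Thm 3.6 (i) p.36] -/
theorem Thm36Sub.ampleTypes_R_ptBase : Thm36Sub.ampleTypes_R ptBase :=
  Thm36Sub.ampleTypes_R_holds ptBase pt_isGraphConnected

section RlfTypologyHead

variable {D' : Type u} [Category.{v} D'] (π' : D' ⥤ D0)

/-- **Thm. 3.6 (i)**, typology clauses, with the SCHEMA head `Thm36i_ampleTypes` (row F-0690's predicate) AT
THE GENUINE CARRIER `C^ℝ := C^rlf` (`Thm36Sub.rlfStr π'`), `D'` connected (= F-2716 unfolded).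
[cite: MochizukiFrdII2008, Thm 3.6 (i) p.36] -/
theorem thm36i_ampleTypes_inst_rlf (hD : IsGraphConnected D') : Thm36i_ampleTypes (Thm36Sub.rlfStr π') :=
  Thm36Sub.ampleTypes_R_holds π' hD

end RlfTypologyHead

end ArchFrd

end Literature.AlgebraicGeometry.Frobenioids
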